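import Literature.Computability.AlgebraicComplexity.GKSS19Lemma24
import Literature.Computability.AlgebraicComplexity.GKSS19Nondegenerate
import Literature.Computability.AlgebraicComplexity.GKSS19GridInterpolation
import HarnessLib

/-!
# Guo–Kumar–Saptharishi–Solomon 2019, §3 "Reconstructing `P_{n+j}` from the inductive claim":
# the algebra of one reconstruction level

Cell `val-lit`, seat t19 (literature-prover); groundwork for the discharge programme of
`GKSS2019_mainThm` (v2, erratum A34) along the printed proof of [GKSS19, §3]. One bookkeeping
definition (`expBox k m`, the finset of exponent vectors with entries `≤ m`, indexing the carried
`y`-coefficients) and THEOREMS; no named facts; nothing here bears on `VP ≠ VNP`, which is NOT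
proved.

Source: Z. Guo, M. Kumar, R. Saptharishi, N. Solomon, *Derandomization from algebraic hardness*,
SIAM J. Comput. 51 (2022) = arXiv:1905.00091 [GuoKumarSaptharishiSolomon2019], §3, Lemma 24 and
the paragraphs "Reconstructing `P_{n+j}` from the inductive claim" / "Obtaining a circuit for `P`"
(held text `paper:arxiv-1905.00091`, p0011.txt:L60–L90, p0012.txt:L1–L28).

## What is here (in the `R[y]`-rendering, `R = F[z]`; `c_{ℓ,e} := coeff e (shiftR P_ℓ)`,
## `P_ℓ = homogeneousComponent ℓ P`, are the carried quantities — `∂_z^e P_ℓ · z`-data of the print)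

* **`lemma24_level`** — Lemma 24 instantiated at level `L = m + j`: for a point `a` with
  `Ψ(a) ≠ 0`, `Δ_m(P_L)(z,a) = (-1/Ψ(a)) · [Q''(R^{(L)}_a)]_{L-m}` where
  `R^{(L)}_a,i = Σ_{ℓ<L} Δ_i(P_ℓ)(z,a)` (the hypotheses `hcong` of `AC/GKSS19Lemma24.lemma24` are
  discharged from Obs. 22 = the bidegree lemmas of `AC/GKSS19ShiftCalculus`);
* `eval_homogeneousComponent_shiftR_eq_sum_expBox` — `Δ_i(P_ℓ)(z,a) = Σ_{e ∈ box, |e| = i} a^e c_{ℓ,e}`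
  (the linear forms feeding `R^{(L)}_a`);
* `coeff_shiftR_eq_sum_grid` — interpolation on the shifted grid `v + {0..m}^k`: for `|e| = m`,
  `c_{L,e} = Σ_α λ_{e,α} · Δ_m(P_L)(z, v+α)` ("an interpolating set … compute `Δ_n(P_{n+j})`");
* `coeff_shiftR_eq_euler` — descent to `|e| < m` (hence to `c_{L,0} = P_L`) by the Euler
  identity in characteristic `0` ("Obtaining a circuit for `P`": the print divides by `y^e` and
  looks at `y^0`; here the equivalent derivative-free bookkeeping of `AC/GKSS19ShiftCalculus`);
* `eq_sum_coeff_zero_shiftR` — `P = Σ_{ℓ ≤ d} c_{ℓ,0}`.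

The circuit bookkeeping (sizes, via `AC/GKSS19PartialHomogenisation.hc_graft_complexity`) is the
next file; this one is pure algebra.

## References
* [GuoKumarSaptharishiSolomon2019] arXiv:1905.00091, §3 (p0011.txt:L60–90, p0012.txt:L1–28).
-/

noncomputable section

open MvPolynomial

namespace Literature.Computability.AlgebraicComplexity

namespace GKSS2019

universe u

variable {F : Type u} [Field F] {k : ℕ}

/-! ### The exponent box -/

/-- The exponent vectors `e ∈ ℕ^k` with all entries `≤ m` (a superset of those of degree `≤ m`),
as a finset; it indexes the carried coefficients `c_{ℓ,e}`. [cite: GuoKumarSaptharishiSolomon2019, §3 "Obtaining a circuit for P" (arXiv p0012.txt:L5-20)] -/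
def expBox (k m : ℕ) : Finset (Fin k →₀ ℕ) :=
  (Finset.univ : Finset (Fin k → Fin (m + 1))).image
    fun β => Finsupp.equivFunOnFinite.symm fun j => (β j : ℕ)

/-- Membership in the box. [cite: GuoKumarSaptharishiSolomon2019, §3 (arXiv p0012.txt:L5-20)] -/
theorem mem_expBox {m : ℕ} {e : Fin k →₀ ℕ} : e ∈ expBox k m ↔ ∀ j, e j ≤ m := by
  constructor
  · rintro he j
    obtain ⟨β, -, rfl⟩ := Finset.mem_image.mp he
    rw [Finsupp.coe_equivFunOnFinite_symm]
    exact Nat.lt_succ_iff.mp (β j).isLt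
  · intro he
    refine Finset.mem_image.mpr ⟨fun j => ⟨e j, Nat.lt_succ_of_le (he j)⟩, Finset.mem_univ _, ?_⟩
    ext j
    simp

/-- The box has at most `(m+1)^k` elements. [cite: GuoKumarSaptharishiSolomon2019, §3 (arXiv p0012.txt:L5-20)] -/
theorem card_expBox_le (k m : ℕ) : (expBox k m).card ≤ (m + 1) ^ k :=
  Finset.card_image_le.trans (by simp)

/-- Exponents of degree `≤ m` lie in the box. [cite: GuoKumarSaptharishiSolomon2019, §3 (arXiv p0012.txt:L5-20)] -/
theorem mem_expBox_of_degree_le {m : ℕ} {e : Fin k →₀ ℕ} (he : e.degree ≤ m) : e ∈ expBox k m :=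
  mem_expBox.mpr fun j => (Finsupp.le_degree j e).trans he

/-! ### The linear forms `Δ_i(P_ℓ)(z, a)` in the carried coefficients -/

/-- `Δ_i(X)(z,a) = Σ_{e ∈ box_m, |e| = i} a^e · coeff_e (shiftR X)` for `i ≤ m`: the sum over the
support in `AC/GKSS19ShiftCalculus.eval_homogeneousComponent_shiftR` re-indexed by the fixed box.
[cite: GuoKumarSaptharishiSolomon2019, §3 (arXiv p0011.txt:L84-88), "a linear combination of its evaluations"] -/
theorem eval_homogeneousComponent_shiftR_eq_sum_expBox (X' : MvPolynomial (Fin k) F)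
    (a : Fin k → F) {i m : ℕ} (hi : i ≤ m) :
    eval (fun j => C (a j)) (homogeneousComponent i (shiftR X')) =
      ∑ e ∈ (expBox k m).filter (fun e => e.degree = i),
        C (∏ j, a j ^ e j) * coeff e (shiftR X') := by
  classical
  rw [eval_homogeneousComponent_shiftR]
  refine Finset.sum_subset (fun e he => ?_) (fun e he hne => ?_)
  · rw [Finset.mem_filter] at he ⊢
    exact ⟨mem_expBox_of_degree_le (he.2.le.trans hi), he.2⟩
  · have hdeg : e.degree = i := (Finset.mem_filter.mp he).2
    have hns : e ∉ (shiftR X').support := fun hs => hne (Finset.mem_filter.mpr ⟨hs, hdeg⟩)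
    rw [notMem_support_iff.mp hns, mul_zero]

/-! ### Lemma 24 at level `L` -/

/-- **Lemma 24 at level `L = m + j` (`j ≥ 1`)**: with `Q''(Δ_0(P), …, Δ_m(P)) = 0` and a point `a`
with `Ψ(a) = (∂_{x_m} Q'')(Δ(P))(0, a) ≠ 0`,
`Δ_m(P_L)(z, a) = (-1/Ψ(a)) · [Q''(R_0, …, R_m)]_{L-m}`, `R_i = Σ_{ℓ<L} Δ_i(P_ℓ)(z, a)`
("`(-1/Ψ(a)) C'(Γ_{j-1,a}) = Δ_n(P_{n+j})(z,a) mod ⟨z⟩^{j+1}`", read in degree `j`).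
[cite: GuoKumarSaptharishiSolomon2019, Lemma 24 and §3.1 (arXiv p0011.txt:L72-76, p0012.txt:L30-74)] -/
theorem lemma24_level (P : MvPolynomial (Fin k) F) {m L : ℕ} (hL : m + 1 ≤ L)
    (Q : MvPolynomial (Fin (m + 1)) F)
    (h0 : aeval (fun i : Fin (m + 1) => homogeneousComponent (i : ℕ) (shiftR P)) Q = 0)
    (a : Fin k → F)
    (hΨ : constantCoeff (aeval (fun i : Fin (m + 1) => eval (fun j => (C (a j) : MvPolynomial (Fin k) F))
      (homogeneousComponent (i : ℕ) (shiftR P))) (pderiv (Fin.last m) Q)) ≠ 0) :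
    eval (fun j => (C (a j) : MvPolynomial (Fin k) F))
        (homogeneousComponent m (shiftR (homogeneousComponent L P))) =
      C (-(constantCoeff (aeval (fun i : Fin (m + 1) =>
          eval (fun j => (C (a j) : MvPolynomial (Fin k) F))
            (homogeneousComponent (i : ℕ) (shiftR P))) (pderiv (Fin.last m) Q)))⁻¹) *
        homogeneousComponent (L - m) (aeval (fun i : Fin (m + 1) => ∑ ℓ ∈ Finset.range L,
          eval (fun j => (C (a j) : MvPolynomial (Fin k) F))
            (homogeneousComponent (i : ℕ) (shiftR (homogeneousComponent ℓ P)))) Q) := by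
  classical
  -- the summands `T ℓ i = Δ_i(P_ℓ)(z, a)` and their degrees
  set T : ℕ → ℕ → MvPolynomial (Fin k) F := fun ℓ i =>
    eval (fun j => (C (a j) : MvPolynomial (Fin k) F))
      (homogeneousComponent i (shiftR (homogeneousComponent ℓ P))) with hT
  have hThom : ∀ ℓ i, (T ℓ i).IsHomogeneous (ℓ - i) := fun ℓ i =>
    isHomogeneous_eval_homogeneousComponent_shiftR (homogeneousComponent_isHomogeneous ℓ P) a i
  -- `Δ_i(P)(z,a) = Σ_{ℓ < M} T ℓ i` for `M` past the total degree
  set M := L + P.totalDegree + 1 with hM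
  have hsplit : ∀ i : ℕ, eval (fun j => (C (a j) : MvPolynomial (Fin k) F))
      (homogeneousComponent i (shiftR P)) = ∑ ℓ ∈ Finset.range M, T ℓ i := by
    intro i
    have hP : P = ∑ ℓ ∈ Finset.range M, homogeneousComponent ℓ P := by
      conv_lhs => rw [← sum_homogeneousComponent (φ := P)]
      refine Finset.sum_subset (Finset.range_subset_range.mpr (by omega)) fun ℓ hℓM hℓ => ?_
      rw [Finset.mem_range, not_lt] at hℓ
      exact homogeneousComponent_eq_zero _ _ (by omega)
    conv_lhs => rw [hP, shiftR_apply, map_sum, map_sum, map_sum]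
    refine Finset.sum_congr rfl fun ℓ _ => ?_
    simp only [hT, shiftR_apply]
  -- apply the abstract Lemma 24
  have hj : 1 ≤ L - m := by omega
  have hA : (T L m).IsHomogeneous (L - m) := hThom L m
  have key := lemma24 (σ' := Fin k) hj Q
    (fun i : Fin (m + 1) => eval (fun j => (C (a j) : MvPolynomial (Fin k) F))
      (homogeneousComponent (i : ℕ) (shiftR P)))
    (fun i : Fin (m + 1) => ∑ ℓ ∈ Finset.range L, T ℓ i) (T L m) hA ?_ ?_ hΨ
  · simpa only [hT] using key
  · -- hcong, from the bidegrees (Obs. 22)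
    intro i
    have hiM : (i : ℕ) ≤ m := Nat.lt_succ_iff.mp i.isLt
    rw [hsplit, ← Finset.sum_range_add_sum_Ico _ (by omega : L ≤ M), add_sub_cancel_left,
      Finset.sum_eq_sum_Ico_succ_bot (by omega : L < M)]
    by_cases hi : i = Fin.last m
    · subst hi
      rw [if_pos rfl, Fin.val_last, add_sub_cancel_left]
      refine VanishesBelow.sum _ fun ℓ hℓ => ?_
      rw [Finset.mem_Ico] at hℓ
      exact VanishesBelow.of_isHomogeneous (hThom ℓ m) (by omega)
    · rw [if_neg hi, sub_zero]
      have him : (i : ℕ) < m := by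
        rcases lt_or_eq_of_le hiM with h | h
        · exact h
        · exact absurd (Fin.ext (by rw [h, Fin.val_last])) hi
      refine (VanishesBelow.of_isHomogeneous (hThom L i) (by omega)).add
        (VanishesBelow.sum _ fun ℓ hℓ => ?_)
      rw [Finset.mem_Ico] at hℓ
      exact VanishesBelow.of_isHomogeneous (hThom ℓ i) (by omega)
  · -- hzero
    rw [← eval_C_aeval, h0, map_zero]

/-! ### Interpolation on the shifted grid -/

/-- The shifted integer nodes `v_i + 0, …, v_i + m` are distinct in characteristic `0`.
[cite: GuoKumarSaptharishiSolomon2019, §3 (arXiv p0011.txt:L77-82)] -/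
theorem shiftedNodes_injective [CharZero F] {m : ℕ} (c : F) :
    Function.Injective (fun a : Fin (m + 1) => c + ((a : ℕ) : F)) := fun a b hab => by
  have h : ((a : ℕ) : F) = ((b : ℕ) : F) := add_left_cancel hab
  exact Fin.ext (Nat.cast_injective h)

/-- **Interpolation of the top coefficients** ("an interpolating set for `Δ_n(P_{n+j})`"): for
`|e| = m`, `c_{L,e} = coeff_e Δ_m(P_L) = Σ_{α ∈ {0..m}^k} λ_{e,α} · Δ_m(P_L)(z, v + α)` on the
shifted grid. [cite: GuoKumarSaptharishiSolomon2019, §3 (arXiv p0011.txt:L77-90)] -/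
theorem coeff_shiftR_eq_sum_grid [CharZero F] (X' : MvPolynomial (Fin k) F) {m : ℕ}
    (v : Fin k → F) (e : Fin k →₀ ℕ) (he : e.degree = m) :
    coeff e (shiftR X') = ∑ α : Fin k → Fin (m + 1),
      (∏ i, nodalDual (fun a : Fin (m + 1) => v i + ((a : ℕ) : F)) (e i) (α i)) •
        eval (fun j => (C (v j + ((α j : ℕ) : F)) : MvPolynomial (Fin k) F))
          (homogeneousComponent m (shiftR X')) := by
  classical
  have hce : coeff e (shiftR X') = coeff e (homogeneousComponent m (shiftR X')) := by
    rw [coeff_homogeneousComponent, if_pos he]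
  rw [hce, coeff_eq_sum_smul_eval_nodes (F := F) (homogeneousComponent m (shiftR X'))
    (d := m) (w := fun i (a : Fin (m + 1)) => v i + ((a : ℕ) : F)) ?_ (fun i => shiftedNodes_injective (v i)) e]
  · simp only [MvPolynomial.algebraMap_eq]
  · intro s hs i
    have hsdeg : s.degree = m := by
      rw [mem_support_iff, coeff_homogeneousComponent] at hs
      by_contra h
      exact hs (if_neg h)
    exact (Finsupp.le_degree i s).trans hsdeg.le

/-! ### Euler descent and the final sum -/

/-- **Descent below degree `m`** by the Euler identity (characteristic `0`): for `P_L` homogeneous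
of degree `L` and `|e| < L`,
`c_{L,e} = (L - |e|)⁻¹ · Σ_j (e_j + 1) z_j c_{L,e+δ_j}`. [cite: GuoKumarSaptharishiSolomon2019, §3 "Obtaining a circuit for P" (arXiv p0012.txt:L5-28)] -/
theorem coeff_shiftR_eq_euler [CharZero F] {X' : MvPolynomial (Fin k) F} {L : ℕ}
    (hX : X'.IsHomogeneous L) (e : Fin k →₀ ℕ) (he : e.degree < L) :
    coeff e (shiftR X') = C ((((L - e.degree : ℕ) : F))⁻¹) *
      ∑ j : Fin k, ((e j + 1 : ℕ) : MvPolynomial (Fin k) F) *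
        (X j * coeff (e + Finsupp.single j 1) (shiftR X')) := by
  rw [euler_coeff_shiftR hX e, ← mul_assoc, ← map_natCast (C : F →+* MvPolynomial (Fin k) F),
    ← map_mul, inv_mul_cancel₀ (Nat.cast_ne_zero.mpr (by omega)), map_one, one_mul]

/-- **`P = Σ_{ℓ ≤ d} c_{ℓ,0}`** (`c_{ℓ,0} = P_ℓ`). [cite: GuoKumarSaptharishiSolomon2019, §3 "Obtaining a circuit for P" (arXiv p0012.txt:L22-28)] -/
theorem eq_sum_coeff_zero_shiftR (P : MvPolynomial (Fin k) F) {d : ℕ} (hd : P.totalDegree ≤ d) :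
    P = ∑ ℓ ∈ Finset.range (d + 1), coeff 0 (shiftR (homogeneousComponent ℓ P)) := by
  simp_rw [coeff_zero_shiftR]
  conv_lhs => rw [← sum_homogeneousComponent (φ := P)]
  refine Finset.sum_subset (Finset.range_subset_range.mpr (by omega)) fun ℓ _ hℓ => ?_
  rw [Finset.mem_range, not_lt] at hℓ
  exact homogeneousComponent_eq_zero _ _ (by omega)

end GKSS2019

end Literature.Computability.AlgebraicComplexity
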